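import Mathlib

/-!
# CHEAP bookkeeping of the line `digit-frame-closure` — the five budgets from the algebraic size bounds
(negative side of `TaylorCertificates.KolmogorovFloor`, crux stmt-AnomalousDissipation-15122)

cdisprove seat `refuter-cdisprove-stmt-AnomalousDissipation-15122-0` (2026-08-16). Pure real analysis, file 2 of the
CHEAP bookkeeping. With the size parameter `Q = η^{-1/40}` dominating every frame/response product
(`Pr ≤ 9Q`, `Cb² ≤ a²Q`, `Pr Cb² ≤ 9a²Q`, `Pr Cb³ ≤ 9a³Q`, `ℓ² ≤ Cl²Q`), the truncation facts
`3Cb/η ≤ Jr² ≤ 9Cb/η + 6`, the amplitude identities `s² = η^{-11/10}/(8π²Pr)`, `t² = 8π²Pr η^{11/10}`, the tail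
`Ts ≤ η²`, and four absorbed constants (`C·η^γ ≤ 1`), the five numeric inequalities of `cheapAt_of_farField` hold:
enstrophy and energy `≤ η^{-11/10}` and slope `≤ η^{-3/5}` (`cheap_budgets_123`), work `≤ η^{2/5}` and defect
`≤ η` (`cheap_budgets_45`). Every comparison is reduced to squares (`sq_le_sq₀`) and products of explicit bounds.
-/

noncomputable section

set_option linter.dupNamespace false

open Real

namespace Summit.AnomalousDissipation.AnomalousDissipation.Theorems.KolmogorovFloor.Negative

set_option maxHeartbeats 800000 in
/-- **Budgets 1–3 (enstrophy, energy, slope).** -/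
theorem cheap_budgets_123 {η Q a Cl Pr Cb ℓ Jr s t : ℝ} (hη : 0 < η) (hη1 : η ≤ 1) (hQ : Q = η ^ (-(1 / 40 : ℝ)))
    (hPr1 : 1 ≤ Pr) (hCb0 : 0 ≤ Cb) (hJr0 : 0 < Jr)
    (ePrCb2 : Pr * Cb ^ 2 ≤ 9 * a ^ 2 * Q) (ePrCb3 : Pr * Cb ^ 3 ≤ 9 * a ^ 3 * Q) (hℓ2 : ℓ ^ 2 ≤ Cl ^ 2 * Q)
    (hJr_hi : Jr ^ 2 ≤ 9 * Cb / η + 6)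
    (hspos : 0 < s) (hs2 : s ^ 2 = η ^ (-(11 / 10 : ℝ)) / (8 * Real.pi ^ 2 * Pr))
    (htpos : 0 < t) (ht2 : t ^ 2 = 8 * Real.pi ^ 2 * Pr * η ^ (11 / 10 : ℝ))
    (a4 : (2 * (1296 * Real.pi ^ 2 * a ^ 3 + 864 * Real.pi ^ 2 * a ^ 2)) * η ^ (3 / 40 : ℝ) ≤ 1)
    (a5 : (2 * (288 * Real.pi ^ 2 * a ^ 2 * Cl ^ 2)) * η ^ (21 / 20 : ℝ) ≤ 1) :
    2 * s ^ 2 * (2 * Real.pi ^ 2 * Pr) + 2 * t ^ 2 * (Cb * Jr) ^ 2 ≤ η ^ (-(11 / 10 : ℝ)) ∧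
    (∀ e2 : ℝ, 0 ≤ e2 → e2 ≤ Pr → 2 * s ^ 2 * (e2 / 2) + 2 * t ^ 2 * (Cb * ℓ) ^ 2 ≤ η ^ (-(11 / 10 : ℝ))) ∧
    s * Real.sqrt Pr + t * (Cb * Jr) ≤ η ^ (-(3 / 5 : ℝ)) := by
  have hPr0 : 0 < Pr := by linarith only [hPr1]
  have hQ1 : 1 ≤ Q := by rw [hQ]; exact Real.one_le_rpow_of_pos_of_le_one_of_nonpos hη hη1 (by norm_num)
  have hQ0 : 0 ≤ Q := by linarith only [hQ1]
  have hQQ : Q ^ 2 = η ^ (-(1 / 20 : ℝ)) := by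
    rw [hQ, ← Real.rpow_natCast, ← Real.rpow_mul hη.le]; norm_num
  have hη11 : (1 : ℝ) ≤ η ^ (-(11 / 10 : ℝ)) := Real.one_le_rpow_of_pos_of_le_one_of_nonpos hη hη1 (by norm_num)
  have hη65 : (1 : ℝ) ≤ η ^ (-(6 / 5 : ℝ)) := Real.one_le_rpow_of_pos_of_le_one_of_nonpos hη hη1 (by norm_num)
  have hπ : (1 : ℝ) ≤ Real.pi ^ 2 := by have := Real.pi_gt_three; nlinarith only [this]
  have e_a : η ^ (11 / 10 : ℝ) * η⁻¹ = η ^ (1 / 10 : ℝ) := by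
    rw [← Real.rpow_neg_one, ← Real.rpow_add hη]; norm_num
  have e_b : Q * η ^ (1 / 10 : ℝ) = η ^ (3 / 40 : ℝ) := by rw [hQ, ← Real.rpow_add hη]; norm_num
  have e_c : Q * η ^ (11 / 10 : ℝ) ≤ η ^ (3 / 40 : ℝ) := by
    rw [← e_b]
    exact mul_le_mul_of_nonneg_left (Real.rpow_le_rpow_of_exponent_ge hη hη1 (by norm_num)) hQ0
  have e_d : Q ^ 2 * η ^ (11 / 10 : ℝ) = η ^ (21 / 20 : ℝ) := by rw [hQQ, ← Real.rpow_add hη]; norm_num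
  -- the common product `Pr Cb² Jr² ≤ 81 a³ Q η⁻¹ + 54 a² Q`
  have hPCJ : Pr * Cb ^ 2 * Jr ^ 2 ≤ 81 * a ^ 3 * Q * η⁻¹ + 54 * a ^ 2 * Q := by
    have h1 : Pr * Cb ^ 2 * Jr ^ 2 ≤ Pr * Cb ^ 2 * (9 * Cb / η + 6) :=
      mul_le_mul_of_nonneg_left hJr_hi (by positivity)
    have h2 : Pr * Cb ^ 2 * (9 * Cb / η + 6) = 9 * (Pr * Cb ^ 3) * η⁻¹ + 6 * (Pr * Cb ^ 2) := by
      rw [div_eq_mul_inv]; ring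
    rw [h2] at h1
    have h3 : (Pr * Cb ^ 3) * η⁻¹ ≤ (9 * a ^ 3 * Q) * η⁻¹ :=
      mul_le_mul_of_nonneg_right ePrCb3 (by positivity : (0 : ℝ) ≤ η⁻¹)
    linarith only [h1, h3, ePrCb2]
  -- hence `16π² Pr η^{11/10} Cb² Jr² ≤ 1/2`
  have hkey1 : 16 * Real.pi ^ 2 * Pr * η ^ (11 / 10 : ℝ) * Cb ^ 2 * Jr ^ 2 ≤ 1 / 2 := by
    have h1 : 16 * Real.pi ^ 2 * Pr * η ^ (11 / 10 : ℝ) * Cb ^ 2 * Jr ^ 2 =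
        16 * Real.pi ^ 2 * η ^ (11 / 10 : ℝ) * (Pr * Cb ^ 2 * Jr ^ 2) := by ring
    rw [h1]
    have h2 := mul_le_mul_of_nonneg_left hPCJ (by positivity : 0 ≤ 16 * Real.pi ^ 2 * η ^ (11 / 10 : ℝ))
    have h3 : 16 * Real.pi ^ 2 * η ^ (11 / 10 : ℝ) * (81 * a ^ 3 * Q * η⁻¹ + 54 * a ^ 2 * Q) =
        1296 * Real.pi ^ 2 * a ^ 3 * (Q * (η ^ (11 / 10 : ℝ) * η⁻¹)) +
          864 * Real.pi ^ 2 * a ^ 2 * (Q * η ^ (11 / 10 : ℝ)) := by ring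
    rw [h3, e_a, e_b] at h2
    have h4 : 864 * Real.pi ^ 2 * a ^ 2 * (Q * η ^ (11 / 10 : ℝ)) ≤ 864 * Real.pi ^ 2 * a ^ 2 * η ^ (3 / 40 : ℝ) :=
      mul_le_mul_of_nonneg_left e_c (by positivity)
    linarith only [h2, h4, a4]
  refine ⟨?_, ?_, ?_⟩
  · -- (n1) enstrophy
    have h1 : 2 * s ^ 2 * (2 * Real.pi ^ 2 * Pr) = η ^ (-(11 / 10 : ℝ)) / 2 := by
      rw [hs2]; field_simp; ring
    have h2 : 2 * t ^ 2 * (Cb * Jr) ^ 2 = 16 * Real.pi ^ 2 * Pr * η ^ (11 / 10 : ℝ) * Cb ^ 2 * Jr ^ 2 := by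
      rw [ht2]; ring
    rw [h1, h2]
    linarith only [hkey1, hη11]
  · -- (n2) energy
    intro e2 he20 he2Pr
    have h1 : 2 * s ^ 2 * (e2 / 2) ≤ η ^ (-(11 / 10 : ℝ)) / 2 := by
      have e1 : 2 * s ^ 2 * (e2 / 2) = η ^ (-(11 / 10 : ℝ)) * (e2 / (8 * Real.pi ^ 2 * Pr)) := by
        rw [hs2]; field_simp
      rw [e1]
      have h3 : e2 / (8 * Real.pi ^ 2 * Pr) ≤ 1 / 2 := by
        rw [div_le_iff₀ (by positivity)]
        have : 1 * Pr ≤ Real.pi ^ 2 * Pr := mul_le_mul_of_nonneg_right hπ hPr0.le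
        linarith only [this, he2Pr, hPr1]
      have h0 : 0 ≤ η ^ (-(11 / 10 : ℝ)) := by linarith only [hη11]
      have := mul_le_mul_of_nonneg_left h3 h0
      linarith only [this]
    have h2 : 2 * t ^ 2 * (Cb * ℓ) ^ 2 ≤ 1 / 2 := by
      rw [ht2]
      have h3 : 2 * (8 * Real.pi ^ 2 * Pr * η ^ (11 / 10 : ℝ)) * (Cb * ℓ) ^ 2 =
          16 * Real.pi ^ 2 * η ^ (11 / 10 : ℝ) * ((Pr * Cb ^ 2) * ℓ ^ 2) := by ring
      rw [h3]
      have h4 : (Pr * Cb ^ 2) * ℓ ^ 2 ≤ (9 * a ^ 2 * Q) * (Cl ^ 2 * Q) :=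
        mul_le_mul ePrCb2 hℓ2 (by positivity) (by positivity)
      have h5 : 16 * Real.pi ^ 2 * η ^ (11 / 10 : ℝ) * ((9 * a ^ 2 * Q) * (Cl ^ 2 * Q)) =
          144 * Real.pi ^ 2 * a ^ 2 * Cl ^ 2 * (Q ^ 2 * η ^ (11 / 10 : ℝ)) := by ring
      have h6 := mul_le_mul_of_nonneg_left h4 (by positivity : 0 ≤ 16 * Real.pi ^ 2 * η ^ (11 / 10 : ℝ))
      rw [h5, e_d] at h6
      linarith only [h6, a5]
    linarith only [h1, h2, hη11]
  · -- (n3) slope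
    have hA : s * Real.sqrt Pr ≤ η ^ (-(3 / 5 : ℝ)) / 2 := by
      have h0 : 0 ≤ s * Real.sqrt Pr := by positivity
      have h0' : 0 ≤ η ^ (-(3 / 5 : ℝ)) / 2 := by positivity
      rw [← sq_le_sq₀ h0 h0']
      have h1 : (s * Real.sqrt Pr) ^ 2 = η ^ (-(11 / 10 : ℝ)) / (8 * Real.pi ^ 2) := by
        rw [mul_pow, Real.sq_sqrt hPr0.le, hs2]; field_simp
      have h2 : (η ^ (-(3 / 5 : ℝ)) / 2) ^ 2 = η ^ (-(6 / 5 : ℝ)) / 4 := by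
        rw [div_pow, ← Real.rpow_natCast, ← Real.rpow_mul hη.le]; norm_num
      rw [h1, h2]
      have h3 : η ^ (-(11 / 10 : ℝ)) ≤ η ^ (-(6 / 5 : ℝ)) := Real.rpow_le_rpow_of_exponent_ge hη hη1 (by norm_num)
      have h4 : 0 ≤ η ^ (-(6 / 5 : ℝ)) := by linarith only [hη65]
      have h5 : 1 * η ^ (-(6 / 5 : ℝ)) ≤ Real.pi ^ 2 * η ^ (-(6 / 5 : ℝ)) := mul_le_mul_of_nonneg_right hπ h4
      rw [div_le_div_iff₀ (by positivity) (by norm_num)]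
      linarith only [h3, h5, hη65]
    have hB' : t * (Cb * Jr) ≤ η ^ (-(3 / 5 : ℝ)) / 2 := by
      have h0 : 0 ≤ t * (Cb * Jr) := by positivity
      have h0' : 0 ≤ η ^ (-(3 / 5 : ℝ)) / 2 := by positivity
      rw [← sq_le_sq₀ h0 h0']
      have h2 : (η ^ (-(3 / 5 : ℝ)) / 2) ^ 2 = η ^ (-(6 / 5 : ℝ)) / 4 := by
        rw [div_pow, ← Real.rpow_natCast, ← Real.rpow_mul hη.le]; norm_num
      have h1 : (t * (Cb * Jr)) ^ 2 = (8 * Real.pi ^ 2 * Pr * η ^ (11 / 10 : ℝ)) * Cb ^ 2 * Jr ^ 2 := by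
        rw [mul_pow, mul_pow, ht2]; ring
      rw [h1, h2]
      have h3 : (8 * Real.pi ^ 2 * Pr * η ^ (11 / 10 : ℝ)) * Cb ^ 2 * Jr ^ 2 ≤ 1 / 4 := by
        linarith only [hkey1]
      linarith only [h3, hη65]
    linarith only [hA, hB']

set_option maxHeartbeats 800000 in
/-- **Budgets 4–5 (work, defect).** -/
theorem cheap_budgets_45 {η Q a Cl Pr Cb ℓ Jr s t Ts F2 : ℝ} (hη : 0 < η) (hη1 : η ≤ 1) (hη3 : η ≤ 1 / 3)
    (hQ : Q = η ^ (-(1 / 40 : ℝ)))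
    (hPr1 : 1 ≤ Pr) (hJr0 : 0 < Jr) (hF2 : 0 ≤ F2)
    (ePr : Pr ≤ 9 * Q) (eCb2 : Cb ^ 2 ≤ a ^ 2 * Q) (ePrCb2 : Pr * Cb ^ 2 ≤ 9 * a ^ 2 * Q)
    (hℓ2 : ℓ ^ 2 ≤ Cl ^ 2 * Q) (hJr_lo : 3 * Cb / η ≤ Jr ^ 2)
    (hspos : 0 < s) (hs2 : s ^ 2 = η ^ (-(11 / 10 : ℝ)) / (8 * Real.pi ^ 2 * Pr))
    (htpos : 0 < t) (ht2 : t ^ 2 = 8 * Real.pi ^ 2 * Pr * η ^ (11 / 10 : ℝ))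
    (hTs0 : 0 ≤ Ts) (hTsη : Ts ≤ η ^ 2)
    (a7 : (8 * Real.pi ^ 2 * (18 * a ^ 4 * Cl ^ 4 + 18 * F2 ^ 2)) * η ^ (1 / 5 : ℝ) ≤ 1)
    (a8 : (216 * Real.pi ^ 2 * a ^ 2 * Cl ^ 2) * η ^ (1 / 20 : ℝ) ≤ 1) :
    (∀ wU : ℝ, 0 ≤ wU → wU ≤ Real.sqrt Pr * Ts → s * wU + t * (((Cb * ℓ) ^ 2 + F2) / 2) ≤ η ^ (2 / 5 : ℝ)) ∧
    Cb / Jr ^ 2 + t ^ 2 * (Cb * ℓ) ^ 2 + Ts ≤ η := by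
  have hPr0 : 0 < Pr := by linarith only [hPr1]
  have hQ1 : 1 ≤ Q := by rw [hQ]; exact Real.one_le_rpow_of_pos_of_le_one_of_nonpos hη hη1 (by norm_num)
  have hQ0 : 0 ≤ Q := by linarith only [hQ1]
  have hQQ : Q ^ 2 = η ^ (-(1 / 20 : ℝ)) := by
    rw [hQ, ← Real.rpow_natCast, ← Real.rpow_mul hη.le]; norm_num
  have hQ4 : Q ^ 4 = η ^ (-(1 / 10 : ℝ)) := by
    rw [hQ, ← Real.rpow_natCast, ← Real.rpow_mul hη.le]; norm_num
  have hη11 : (1 : ℝ) ≤ η ^ (-(11 / 10 : ℝ)) := Real.one_le_rpow_of_pos_of_le_one_of_nonpos hη hη1 (by norm_num)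
  have hπ : (1 : ℝ) ≤ Real.pi ^ 2 := by have := Real.pi_gt_three; nlinarith only [this]
  have e_d : Q ^ 2 * η ^ (11 / 10 : ℝ) = η ^ (21 / 20 : ℝ) := by rw [hQQ, ← Real.rpow_add hη]; norm_num
  have hpow : ∀ n : ℕ, η ^ n = η ^ (n : ℝ) := fun n => (Real.rpow_natCast η n).symm
  refine ⟨?_, ?_⟩
  · -- (n4) work
    intro wU hwU0 hwU
    have hA : s * wU ≤ η ^ (2 / 5 : ℝ) / 2 := by
      have h0' : 0 ≤ η ^ (2 / 5 : ℝ) / 2 := by positivity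
      have h1 : s * wU ≤ s * (Real.sqrt Pr * Ts) := mul_le_mul_of_nonneg_left hwU hspos.le
      refine h1.trans ?_
      have h00 : 0 ≤ s * (Real.sqrt Pr * Ts) := by positivity
      rw [← sq_le_sq₀ h00 h0']
      have h2 : (s * (Real.sqrt Pr * Ts)) ^ 2 = η ^ (-(11 / 10 : ℝ)) * Ts ^ 2 / (8 * Real.pi ^ 2) := by
        rw [mul_pow, mul_pow, Real.sq_sqrt hPr0.le, hs2]; field_simp
      have h3 : (η ^ (2 / 5 : ℝ) / 2) ^ 2 = η ^ (4 / 5 : ℝ) / 4 := by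
        rw [div_pow, ← Real.rpow_natCast, ← Real.rpow_mul hη.le]; norm_num
      rw [h2, h3]
      have h4 : Ts ^ 2 ≤ (η ^ 2) ^ 2 := pow_le_pow_left₀ hTs0 hTsη 2
      have h5 : η ^ (-(11 / 10 : ℝ)) * (η ^ 2) ^ 2 = η ^ (29 / 10 : ℝ) := by
        rw [← pow_mul, hpow, ← Real.rpow_add hη]; norm_num
      have h6 : η ^ (29 / 10 : ℝ) ≤ η ^ (4 / 5 : ℝ) := Real.rpow_le_rpow_of_exponent_ge hη hη1 (by norm_num)
      have h7 : 0 ≤ η ^ (-(11 / 10 : ℝ)) := by linarith only [hη11]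
      have h8 : η ^ (-(11 / 10 : ℝ)) * Ts ^ 2 ≤ η ^ (4 / 5 : ℝ) := by
        calc η ^ (-(11 / 10 : ℝ)) * Ts ^ 2 ≤ η ^ (-(11 / 10 : ℝ)) * (η ^ 2) ^ 2 := mul_le_mul_of_nonneg_left h4 h7
          _ = η ^ (29 / 10 : ℝ) := h5
          _ ≤ η ^ (4 / 5 : ℝ) := h6
      have h9 : 0 ≤ η ^ (4 / 5 : ℝ) := Real.rpow_nonneg hη.le _
      have h10 : 1 * η ^ (4 / 5 : ℝ) ≤ Real.pi ^ 2 * η ^ (4 / 5 : ℝ) := mul_le_mul_of_nonneg_right hπ h9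
      rw [div_le_div_iff₀ (by positivity) (by norm_num)]
      linarith only [h8, h10, h9]
    have hB' : t * (((Cb * ℓ) ^ 2 + F2) / 2) ≤ η ^ (2 / 5 : ℝ) / 2 := by
      have h0 : 0 ≤ t * (((Cb * ℓ) ^ 2 + F2) / 2) := by positivity
      have h0' : 0 ≤ η ^ (2 / 5 : ℝ) / 2 := by positivity
      rw [← sq_le_sq₀ h0 h0']
      have h3 : (η ^ (2 / 5 : ℝ) / 2) ^ 2 = η ^ (4 / 5 : ℝ) / 4 := by
        rw [div_pow, ← Real.rpow_natCast, ← Real.rpow_mul hη.le]; norm_num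
      have h1 : (t * (((Cb * ℓ) ^ 2 + F2) / 2)) ^ 2 = t ^ 2 * ((Cb * ℓ) ^ 2 + F2) ^ 2 / 4 := by ring
      rw [h1, h3, ht2]
      have h4 : ((Cb * ℓ) ^ 2 + F2) ^ 2 ≤ 2 * (Cb ^ 4 * ℓ ^ 4) + 2 * F2 ^ 2 := by
        nlinarith only [sq_nonneg ((Cb * ℓ) ^ 2 - F2)]
      have h5 : Pr * (Cb ^ 4 * ℓ ^ 4) ≤ (9 * a ^ 2 * Q) * (a ^ 2 * Q) * (Cl ^ 2 * Q) ^ 2 := by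
        have e1 : Pr * (Cb ^ 4 * ℓ ^ 4) = (Pr * Cb ^ 2) * Cb ^ 2 * (ℓ ^ 2) ^ 2 := by ring
        rw [e1]
        have hℓ4 : (ℓ ^ 2) ^ 2 ≤ (Cl ^ 2 * Q) ^ 2 := pow_le_pow_left₀ (by positivity) hℓ2 2
        exact mul_le_mul (mul_le_mul ePrCb2 eCb2 (by positivity) (by positivity)) hℓ4
          (by positivity) (by positivity)
      have h6 : Pr * F2 ^ 2 ≤ 9 * Q * F2 ^ 2 := mul_le_mul_of_nonneg_right ePr (by positivity)
      have h7a : Pr * ((Cb * ℓ) ^ 2 + F2) ^ 2 ≤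
          2 * ((9 * a ^ 2 * Q) * (a ^ 2 * Q) * (Cl ^ 2 * Q) ^ 2) + 2 * (9 * Q * F2 ^ 2) := by
        have hh := mul_le_mul_of_nonneg_left h4 hPr0.le
        have hh2 : Pr * (2 * (Cb ^ 4 * ℓ ^ 4) + 2 * F2 ^ 2) = 2 * (Pr * (Cb ^ 4 * ℓ ^ 4)) + 2 * (Pr * F2 ^ 2) := by
          ring
        rw [hh2] at hh
        linarith only [hh, h5, h6]
      have h0'' : 0 ≤ 8 * Real.pi ^ 2 * η ^ (11 / 10 : ℝ) := by positivity
      have h7 := mul_le_mul_of_nonneg_left h7a h0''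
      have e1 : Q ^ 4 * η ^ (11 / 10 : ℝ) = η ^ (1 : ℝ) := by rw [hQ4, ← Real.rpow_add hη]; norm_num
      have e2 : Q * η ^ (11 / 10 : ℝ) ≤ η ^ (1 : ℝ) := by
        rw [← e1]
        have hQ14 : Q ≤ Q ^ 4 := le_self_pow₀ hQ1 (by norm_num)
        exact mul_le_mul_of_nonneg_right hQ14 (Real.rpow_nonneg hη.le _)
      have e3 : η ^ (1 : ℝ) = η ^ (1 / 5 : ℝ) * η ^ (4 / 5 : ℝ) := by rw [← Real.rpow_add hη]; norm_num
      have h8 : 8 * Real.pi ^ 2 * η ^ (11 / 10 : ℝ) *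
            (2 * ((9 * a ^ 2 * Q) * (a ^ 2 * Q) * (Cl ^ 2 * Q) ^ 2) + 2 * (9 * Q * F2 ^ 2)) =
          8 * Real.pi ^ 2 * (18 * a ^ 4 * Cl ^ 4) * (Q ^ 4 * η ^ (11 / 10 : ℝ)) +
            8 * Real.pi ^ 2 * (18 * F2 ^ 2) * (Q * η ^ (11 / 10 : ℝ)) := by ring
      rw [h8, e1] at h7
      have h9 : 8 * Real.pi ^ 2 * (18 * F2 ^ 2) * (Q * η ^ (11 / 10 : ℝ)) ≤
          8 * Real.pi ^ 2 * (18 * F2 ^ 2) * η ^ (1 : ℝ) :=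
        mul_le_mul_of_nonneg_left e2 (by positivity)
      have h10 : 8 * Real.pi ^ 2 * η ^ (11 / 10 : ℝ) * (Pr * ((Cb * ℓ) ^ 2 + F2) ^ 2) ≤
          (8 * Real.pi ^ 2 * (18 * a ^ 4 * Cl ^ 4 + 18 * F2 ^ 2)) * η ^ (1 : ℝ) := by
        linarith only [h7, h9]
      rw [e3] at h10
      have h12 : 0 ≤ η ^ (4 / 5 : ℝ) := Real.rpow_nonneg hη.le _
      have h13 : ((8 * Real.pi ^ 2 * (18 * a ^ 4 * Cl ^ 4 + 18 * F2 ^ 2)) * η ^ (1 / 5 : ℝ)) * η ^ (4 / 5 : ℝ) ≤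
          1 * η ^ (4 / 5 : ℝ) := mul_le_mul_of_nonneg_right a7 h12
      have h14 : 8 * Real.pi ^ 2 * Pr * η ^ (11 / 10 : ℝ) * ((Cb * ℓ) ^ 2 + F2) ^ 2 =
          8 * Real.pi ^ 2 * η ^ (11 / 10 : ℝ) * (Pr * ((Cb * ℓ) ^ 2 + F2) ^ 2) := by ring
      rw [div_le_div_iff₀ (by norm_num) (by norm_num), h14]
      have h15 : (8 * Real.pi ^ 2 * (18 * a ^ 4 * Cl ^ 4 + 18 * F2 ^ 2)) * (η ^ (1 / 5 : ℝ) * η ^ (4 / 5 : ℝ)) =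
          ((8 * Real.pi ^ 2 * (18 * a ^ 4 * Cl ^ 4 + 18 * F2 ^ 2)) * η ^ (1 / 5 : ℝ)) * η ^ (4 / 5 : ℝ) := by ring
      rw [h15] at h10
      linarith only [h10, h13]
    linarith only [hA, hB']
  · -- (n5) defect
    have hA : Cb / Jr ^ 2 ≤ η / 3 := by
      rw [div_le_iff₀ (by positivity)]
      have h1 : 3 * Cb ≤ Jr ^ 2 * η := by
        have := hJr_lo; rwa [div_le_iff₀ hη] at this
      linarith only [h1]
    have hB' : t ^ 2 * (Cb * ℓ) ^ 2 ≤ η / 3 := by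
      rw [ht2]
      have h3 : (8 * Real.pi ^ 2 * Pr * η ^ (11 / 10 : ℝ)) * (Cb * ℓ) ^ 2 =
          8 * Real.pi ^ 2 * η ^ (11 / 10 : ℝ) * ((Pr * Cb ^ 2) * ℓ ^ 2) := by ring
      rw [h3]
      have h4 : (Pr * Cb ^ 2) * ℓ ^ 2 ≤ (9 * a ^ 2 * Q) * (Cl ^ 2 * Q) :=
        mul_le_mul ePrCb2 hℓ2 (by positivity) (by positivity)
      have h6 := mul_le_mul_of_nonneg_left h4 (by positivity : 0 ≤ 8 * Real.pi ^ 2 * η ^ (11 / 10 : ℝ))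
      have h5 : 8 * Real.pi ^ 2 * η ^ (11 / 10 : ℝ) * ((9 * a ^ 2 * Q) * (Cl ^ 2 * Q)) =
          72 * Real.pi ^ 2 * a ^ 2 * Cl ^ 2 * (Q ^ 2 * η ^ (11 / 10 : ℝ)) := by ring
      rw [h5, e_d] at h6
      have e4 : η ^ (21 / 20 : ℝ) = η ^ (1 / 20 : ℝ) * η := by
        rw [show (21 / 20 : ℝ) = 1 / 20 + 1 by norm_num, Real.rpow_add hη, Real.rpow_one]
      rw [e4] at h6
      have h8 : 72 * Real.pi ^ 2 * a ^ 2 * Cl ^ 2 * (η ^ (1 / 20 : ℝ) * η) =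
          ((216 * Real.pi ^ 2 * a ^ 2 * Cl ^ 2) * η ^ (1 / 20 : ℝ)) * (η / 3) := by ring
      rw [h8] at h6
      have h9 : ((216 * Real.pi ^ 2 * a ^ 2 * Cl ^ 2) * η ^ (1 / 20 : ℝ)) * (η / 3) ≤ 1 * (η / 3) :=
        mul_le_mul_of_nonneg_right a8 (by positivity)
      linarith only [h6, h9]
    have hC' : Ts ≤ η / 3 := by
      have : η * η ≤ η * (1 / 3) := mul_le_mul_of_nonneg_left hη3 hη.le
      have h2 : η ^ 2 = η * η := sq η
      linarith only [this, h2, hTsη]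
    linarith only [hA, hB', hC']

end Summit.AnomalousDissipation.AnomalousDissipation.Theorems.KolmogorovFloor.Negative
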